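import Mathlib
import Summits.Schanuel.Schanuel.Theses.MatrixCoefficients
import HarnessLib

/-!
# Crux `LogSector` (stmt-Schanuel-4310) — the strategist's typed GRADING SPLIT into two leaves

Route `MatrixCoefficients` (sub-problem `Schanuel/Schanuel`); deciding crux
`Summit.Schanuel.Schanuel.Theses.MatrixCoefficients.LogSector` (X: `ℚ`-linearly independent logarithms of
algebraic numbers are algebraically independent over `ℚ` — the conjecture of algebraic independence of
logarithms, `= Literature.Barriers.Schanuel.AlgIndepLogarithms` by `Iff.rfl`). The route re-audit binned X
RESTATED; seat `planner-cstrat-stmt-Schanuel-4310-r1-0` (crux-strategist, BC2 redirect) files the split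
`X ⟸ X₁ ∧ X₂` along the GRADING of the polynomial ring `ℚ[X₁,…,Xₙ]` by total degree:

* LEAF 1 `HomLogSector` — the HOMOGENEOUS (projective) conjecture of algebraic independence of logarithms:
  no nonzero homogeneous `P ∈ ℚ[X₁,…,Xₙ]` vanishes at a point of `𝓛ⁿ` with `ℚ`-linearly independent
  coordinates (`𝓛 = exp⁻¹(ℚ̄)`). By Roy 1989 (Waldschmidt, *Diophantine approximation on linear algebraic
  groups* (2000) §1.4 p. 18; Roy 1995 §3.1 Cor. 3.2) it is EQUIVALENT to the Structural Rank Conjecture for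
  matrices with entries in `𝓛` (Dasgupta–Kakde 2024 Conj. 1.1), the conjecture this route's matrix-coefficient
  ladder hangs from; it contains the four exponentials conjecture (a `2 × 2` rank-one pencil over `𝓛` is a
  homogeneous quadratic relation among `ℚ`-independent logarithms).
* LEAF 2 `LogHomogeneity` — Baker's INHOMOGENEITY PRINCIPLE IN ALL DEGREES: every polynomial relation
  `P(l) = 0` among logarithms of algebraic numbers holds homogeneous component by homogeneous component
  (degree `≤ 1` is Baker's theorem `β₀ + Σ βᵢ log αᵢ = 0 ⇒ β₀ = 0`, over `ℚ` already the transcendence of `e`;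
  degree 2 contains "`log 2 · log 3 ∉ ℚ`"; it is verbatim the consequent of route TwistedConjugacy's support
  item `TwistImpliesLogHomogeneity`). Equivalently: the `ℚ`-Zariski closure of every point of `𝓛^r` is a cone;
  equivalently `l₁` is transcendental over the field `ℚ(l₂/l₁, …, lₙ/l₁)` of ratios.

Glue `logSector_of_homLogSector_of_logHomogeneity : HomLogSector → LogHomogeneity → LogSector` (sorry-free,
below): a relation `P(l) = 0` holds degree by degree (LEAF 2), each homogeneous component `P_d` then vanishes
as a polynomial (LEAF 1), and `P = Σ_d P_d` (`MvPolynomial.sum_homogeneousComponent`). The seam is light (the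
graded decomposition of `ℚ[X]`) but NOT a reorder of hypotheses: neither leaf mentions the other or the summit.
Neither leaf is the crux reworded: LEAF 1 says nothing about inhomogeneous relations (at `n = 2` it is the
Gel'fond–Schneider theorem while X(2) is open), LEAF 2 says nothing about the ratios `lᵢ/l₁` (it holds
trivially for homogeneous `P`); Waldschmidt (loc. cit.) records the homogeneous conjecture and the full one as
distinct statements, equivalent respectively to the structural rank conjecture on `Mat(𝓛)` and on
`Mat(ℚ + 𝓛)`. The converse directions (X ⇒ each leaf) are `homLogSector_of_logSector` and
`logHomogeneity_of_logSector` below: the split loses nothing (X ⟺ X₁ ∧ X₂).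
Nothing here closes or refutes stmt-Schanuel-4310.

References: D. Roy, *Matrices dont les coefficients sont des formes linéaires*, Sém. Théor. Nombres Paris
1987–88, Progr. Math. 81 (1990) 273–281 [Roy1989]; M. Waldschmidt, *Diophantine Approximation on Linear
Algebraic Groups*, Grundlehren 326 (2000), §1.4 pp. 17–18 and §12.1.4 [Waldschmidt2000]; D. Roy, Acta Math.
175 (1995) §3.1 Cor. 3.2 and Remark p. 65 [Roy1995]; S. Dasgupta, M. Kakde, arXiv:2408.08178, Conj. 1.1
[DasguptaKakde2024]; A. Baker, *Transcendental Number Theory* (1975) Thm 2.1 [BakerTNT1975].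
-/

noncomputable section

-- `Summit.Schanuel.Schanuel.…` is the mandated summit/sub-problem namespace (single-conjunct summit), hence:
set_option linter.dupNamespace false

namespace Summit.Schanuel.Schanuel.Cruxes.LogSector.GradingSplit

open Summit.Schanuel.Schanuel.Theses.MatrixCoefficients (LogSector)

/-! ## The glue: LEAF 1 → LEAF 2 → X -/

/-- **Grading split of the conjecture of algebraic independence of logarithms** (glue, PROVED): if
(LEAF 1) no nonzero homogeneous rational polynomial vanishes at `ℚ`-linearly independent logarithms of
algebraic numbers, and (LEAF 2) every rational polynomial relation among logarithms of algebraic numbers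
holds homogeneous component by homogeneous component, then `ℚ`-linearly independent logarithms of algebraic
numbers are algebraically independent (`MatrixCoefficients.LogSector`, item stmt-Schanuel-4310). Proof: for
`P(l) = 0`, LEAF 2 gives `P_d(l) = 0` for every `d`, LEAF 1 gives `P_d = 0`, and `P = Σ_d P_d`. -/
theorem logSector_of_homLogSector_of_logHomogeneity
    (h₁ : ∀ (n : ℕ) (l : Fin n → ℂ), (∀ i, IsAlgebraic ℚ (Complex.exp (l i))) →
      LinearIndependent ℚ l → ∀ (d : ℕ) (P : MvPolynomial (Fin n) ℚ), P.IsHomogeneous d → P ≠ 0 →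
        MvPolynomial.aeval l P ≠ 0)
    (h₂ : ∀ (r : ℕ) (l : Fin r → ℂ), (∀ j, IsAlgebraic ℚ (Complex.exp (l j))) →
      ∀ P : MvPolynomial (Fin r) ℚ, MvPolynomial.aeval l P = 0 →
        ∀ d : ℕ, MvPolynomial.aeval l (MvPolynomial.homogeneousComponent d P) = 0) :
    LogSector := by
  intro n l halg hli
  rw [algebraicIndependent_iff]
  intro P hP
  rw [← MvPolynomial.sum_homogeneousComponent P]
  refine Finset.sum_eq_zero fun d _ => ?_
  by_contra hne
  exact h₁ n l halg hli d _ (MvPolynomial.homogeneousComponent_isHomogeneous d P) hne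
    (h₂ n l halg P hP d)

/-! ## Converses: X ⇒ each leaf (the split is exact) -/

/-- X ⇒ LEAF 1: algebraically independent logarithms satisfy no nonzero homogeneous relation
(immediate from `algebraicIndependent_iff`). -/
theorem homLogSector_of_logSector (h : LogSector) :
    ∀ (n : ℕ) (l : Fin n → ℂ), (∀ i, IsAlgebraic ℚ (Complex.exp (l i))) →
      LinearIndependent ℚ l → ∀ (d : ℕ) (P : MvPolynomial (Fin n) ℚ), P.IsHomogeneous d → P ≠ 0 →
        MvPolynomial.aeval l P ≠ 0 := by
  intro n l halg hli d P _ hP h0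
  exact hP ((algebraicIndependent_iff.mp (h n l halg hli)) P h0)

/-- Scaling a homogeneous rational polynomial of degree `d`: `P (c • z) = c ^ d * P z` at complex points.
[folklore] -/
theorem aeval_smul_of_isHomogeneous {σ : Type*} {P : MvPolynomial σ ℚ} {d : ℕ}
    (hP : P.IsHomogeneous d) (c : ℂ) (z : σ → ℂ) :
    MvPolynomial.aeval (c • z) P = c ^ d * MvPolynomial.aeval z P := by
  classical
  simp only [MvPolynomial.aeval_def, MvPolynomial.eval₂_eq, Finset.mul_sum]
  refine Finset.sum_congr rfl fun s hs => ?_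
  have hd : s.degree = d := by
    by_contra h
    exact (MvPolynomial.mem_support_iff.mp hs) (hP.coeff_eq_zero h)
  subst hd
  simp only [Pi.smul_apply, smul_eq_mul, mul_pow, Finset.prod_mul_distrib,
    Finset.prod_pow_eq_pow_sum, Finsupp.degree_apply]
  ring

/-- The cone lemma: if `P (c • z) = 0` for every RATIONAL `c`, then every homogeneous component of `P`
vanishes at `z` (the one-variable polynomial `c ↦ P(c • z) = Σ_d P_d(z) c^d` has infinitely many roots).
[folklore] -/
theorem aeval_homogeneousComponent_eq_zero_of_forall_rat_smul {r : ℕ} (z : Fin r → ℂ)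
    (P : MvPolynomial (Fin r) ℚ) (h : ∀ c : ℚ, MvPolynomial.aeval ((c : ℂ) • z) P = 0) (d : ℕ) :
    MvPolynomial.aeval z (MvPolynomial.homogeneousComponent d P) = 0 := by
  classical
  set q : Polynomial ℂ := ∑ i ∈ Finset.range (P.totalDegree + 1),
    Polynomial.C (MvPolynomial.aeval z (MvPolynomial.homogeneousComponent i P)) *
      Polynomial.X ^ i with hq
  have hq_eval : ∀ c : ℂ, q.eval c = MvPolynomial.aeval (c • z) P := fun c => by
    conv_rhs => rw [← MvPolynomial.sum_homogeneousComponent P, map_sum]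
    simp only [hq, Polynomial.eval_finsetSum, Polynomial.eval_mul, Polynomial.eval_C,
      Polynomial.eval_pow, Polynomial.eval_X]
    refine Finset.sum_congr rfl fun i _ => ?_
    rw [aeval_smul_of_isHomogeneous (MvPolynomial.homogeneousComponent_isHomogeneous i P), mul_comm]
  have hq0 : q = 0 := by
    apply Polynomial.eq_zero_of_infinite_isRoot
    apply Set.Infinite.mono (s := Set.range (fun c : ℚ => (c : ℂ)))
    · rintro _ ⟨c, rfl⟩
      rw [Set.mem_setOf_eq, Polynomial.IsRoot.def, hq_eval]
      exact h c
    · exact Set.infinite_range_of_injective (fun a b hab => by exact_mod_cast hab)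
  have hcoeff : ∀ i, q.coeff i = if i ∈ Finset.range (P.totalDegree + 1) then
      MvPolynomial.aeval z (MvPolynomial.homogeneousComponent i P) else 0 := fun i => by
    simp only [hq, Polynomial.finsetSum_coeff, Polynomial.coeff_C_mul_X_pow]
    rw [Finset.sum_ite_eq]
  by_cases hd : d ∈ Finset.range (P.totalDegree + 1)
  · have := hcoeff d
    rwa [if_pos hd, hq0, Polynomial.coeff_zero, eq_comm] at this
  · rw [Finset.mem_range, not_lt, Nat.succ_le_iff] at hd
    rw [MvPolynomial.homogeneousComponent_eq_zero d P hd, map_zero]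

/-- `𝓛 = exp⁻¹(ℚ̄)` is a `ℚ`-subspace of `ℂ`: `e^{Σ qᵢ wᵢ}` is algebraic when every `e^{wᵢ}` is.
[folklore] -/
theorem isAlgebraic_exp_of_mem_span_logs {w : ℂ}
    (hw : w ∈ Submodule.span ℚ {z : ℂ | IsAlgebraic ℚ (Complex.exp z)}) :
    IsAlgebraic ℚ (Complex.exp w) := by
  induction hw using Submodule.span_induction with
  | mem w hw => exact hw
  | zero => rw [Complex.exp_zero]; exact isAlgebraic_one
  | add u v _ _ hu hv => rw [Complex.exp_add]; exact hu.mul hv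
  | smul q w _ hw =>
    refine IsAlgebraic.of_pow q.den_pos ?_
    have hcast : ((q.den : ℂ)) * (q : ℂ) = (q.num : ℂ) := by
      have h := congrArg (fun r : ℚ => (r : ℂ)) (Rat.den_mul_eq_num q)
      push_cast at h
      exact h
    have key : Complex.exp (q • w) ^ q.den = Complex.exp ((q.num : ℂ) * w) := by
      rw [← Complex.exp_nat_mul, Rat.smul_def, ← mul_assoc, hcast]
    rw [key, Complex.exp_int_mul]
    obtain ⟨N, hN | hN⟩ := q.num.eq_nat_or_neg
    · rw [hN, zpow_natCast]; exact hw.pow N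
    · rw [hN, zpow_neg, zpow_natCast]; exact (hw.pow N).inv

/-- X ⇒ LEAF 2: under the conjecture of algebraic independence of logarithms every relation among
(possibly `ℚ`-dependent) logarithms of algebraic numbers holds degree by degree. Proof: choose a `ℚ`-basis
`b` of `span_ℚ(l) ⊆ 𝓛`; it is algebraically independent (X), so `ℚ[b] ≃ ℚ[X₁,…,X_k]` and the rational
scalings `b ↦ c • b` (`c ∈ ℚ`) are algebra endomorphisms of `ℚ[b]` acting as `v ↦ c • v` on `span_ℚ(l)`;
hence `P(c • l) = 0` for every rational `c`, and the cone lemma concludes. -/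
theorem logHomogeneity_of_logSector (h : LogSector) :
    ∀ (r : ℕ) (l : Fin r → ℂ), (∀ j, IsAlgebraic ℚ (Complex.exp (l j))) →
      ∀ P : MvPolynomial (Fin r) ℚ, MvPolynomial.aeval l P = 0 →
        ∀ d : ℕ, MvPolynomial.aeval l (MvPolynomial.homogeneousComponent d P) = 0 := by
  intro r l halg P hP
  classical
  apply aeval_homogeneousComponent_eq_zero_of_forall_rat_smul
  intro c
  -- a ℚ-basis of V = span_ℚ (range l), as a family b : Fin k → ℂ
  set L : Set ℂ := {z : ℂ | IsAlgebraic ℚ (Complex.exp z)} with hL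
  set V : Submodule ℚ ℂ := Submodule.span ℚ (Set.range l) with hV
  haveI : FiniteDimensional ℚ V := FiniteDimensional.span_of_finite ℚ (Set.finite_range l)
  set k : ℕ := Module.finrank ℚ V with hk
  let bV := Module.finBasis ℚ V
  set b : Fin k → ℂ := fun i => ((bV i : V) : ℂ) with hb
  have hVL : V ≤ Submodule.span ℚ L := Submodule.span_mono (by rintro _ ⟨j, rfl⟩; exact halg j)
  have hb_alg : ∀ i, IsAlgebraic ℚ (Complex.exp (b i)) := fun i =>
    isAlgebraic_exp_of_mem_span_logs (hVL (bV i).2)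
  have hb_li : LinearIndependent ℚ b := bV.linearIndependent.map' V.subtype V.ker_subtype
  have hb_ai : AlgebraicIndependent ℚ b := h k b hb_alg hb_li
  -- coordinates of the lⱼ in the basis b: l j = Σ_i C j i • b i
  have hlV : ∀ j, l j ∈ V := fun j => Submodule.subset_span ⟨j, rfl⟩
  set C : Fin r → Fin k → ℚ := fun j i => bV.repr ⟨l j, hlV j⟩ i with hC
  have hlC : ∀ j, l j = ∑ i, (C j i : ℂ) * b i := fun j => by
    have h1 := bV.sum_repr ⟨l j, hlV j⟩
    have h2 := congrArg (fun v : V => (v : ℂ)) h1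
    simp only [Submodule.coe_sum, Submodule.coe_smul] at h2
    calc l j = ∑ i, (bV.repr ⟨l j, hlV j⟩ i) • b i := h2.symm
      _ = ∑ i, (C j i : ℂ) * b i := Finset.sum_congr rfl fun i _ => by rw [Rat.smul_def]
  -- the linear substitution Xⱼ ↦ Σ_i C j i • Yᵢ
  set Λ : Fin r → MvPolynomial (Fin k) ℚ := fun j => ∑ i, MvPolynomial.C (C j i) * MvPolynomial.X i
    with hΛ
  have hΛeval : ∀ (s : ℂ) (j : Fin r),
      MvPolynomial.aeval (s • b) (Λ j) = s * l j := fun s j => by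
    rw [hlC j, Finset.mul_sum]
    simp only [hΛ, map_sum, map_mul, MvPolynomial.aeval_C, MvPolynomial.aeval_X, Pi.smul_apply,
      smul_eq_mul, eq_ratCast]
    refine Finset.sum_congr rfl fun i _ => ?_
    ring
  -- Q := P(Λ) ∈ ℚ[Y] vanishes at b, hence is 0 by algebraic independence of b
  set Q : MvPolynomial (Fin k) ℚ := MvPolynomial.aeval Λ P with hQ
  have hQeval : ∀ s : ℂ, MvPolynomial.aeval (s • b) Q = MvPolynomial.aeval (s • l) P := fun s => by
    have hfun : (fun j => MvPolynomial.aeval (s • b) (Λ j)) = s • l := by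
      funext j
      rw [hΛeval s j]
      rfl
    rw [hQ, MvPolynomial.comp_aeval_apply, hfun]
  have hQ0 : Q = 0 := by
    apply (algebraicIndependent_iff.mp hb_ai) Q
    have := hQeval 1
    rw [one_smul, one_smul] at this
    rw [this, hP]
  have := hQeval (c : ℂ)
  rw [hQ0, map_zero] at this
  exact this.symm

end Summit.Schanuel.Schanuel.Cruxes.LogSector.GradingSplit

end
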